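import Literature.MathematicalPhysics.QuantumFieldTheory.Balaban1983to89.B9Cor35GCubeInputsAtOne

/-!
# `Balaban1983to89.B9Prop26DirichletBondReading` — [Balaban1984PropagatorsII] Prop. 2.6 (2.136) p. 247 FOR A DIRICHLET BOND KERNEL OF THE CUBE
# SEQUENCE `{Ω_n(□)}` ([Balaban1985BackgroundPropagators] p. 408–409, «G_□(U)» at `U = 1`), READ AS [B9] (3.42)-TYPE BLOCK MAJORANTS OVER THE CUBE
# GEOMETRY `geoCK i □`: the [B6]-geometry of the cube sequence WITH BOND ARGUMENTS (`geoDirB`), the `GFamily` of a real bond kernel (`gFamOfKernelB`),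
# and the reading `Ineq2136_2140 ⇒ HasMajorant` (`hasMajorant_of_ineq2136`) — road (B5) of the N06 bond rows, seat dag-n06-c g33, FILE 1

statement-level skeleton of published theorems with citation tags; proofs where landed; nothing here is a claim about the Yang–Mills mass gap

CITATION HEADER (lean-in-tree rule).  [4] = B6 = T. Bałaban, *Propagators and renormalization transformations for lattice gauge theories. II*, Commun.
Math. Phys. **96** (1984) 223–250 [Balaban1984PropagatorsII] (held `paper:balaban1984-cmp96-propagators-rt-ii`; journal page = PDF page + 222): Prop. 2.6
(2.136) p. 247 «|(GJ)(x)|, |(∇GJ)(x)|, |(G∇*J)(x)|, |(ΔGJ)(x)| ≤ O(1)[(L^jη)², L^jη, L^jη, 1]e^{−δ₃d(y,y′)}|J| for x ∈ Δ(y), y ∈ Λ_j, supp J ⊂ Δ(y′)»;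
p. 228 after (2.35) and p. 248 l. 4–5 («this theorem holds for the operators G(Ω) with Dirichlet boundary conditions on Ωᶜ, Ω ⊃ Ω₁») — the tree's
named printed assertion `B6.Prop26DirichletPrinted` (`B6Prop26DirichletPrinted`, lit-balaban typer g57); (2.51) p. 232 (block majorants); (2.1)–(2.4)
p. 224.  B9 = T. Bałaban, *Propagators for lattice gauge theories in a background field*, Commun. Math. Phys. **99** (1985) 389–434
[Balaban1985BackgroundPropagators]: p. 408 (last lines)–p. 409 l. 5 («the sequence {Ω_n(□)} … The operators constructed for this sequence, which we
denote by G′_□(U), C_□(U), G_□(U), satisfy all the inequalities of Theorems 3.1–3.3»), Thm 3.3 p. 399, (3.42) p. 397, Cor. 3.5 p. 407 («with U = 1,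
these theorems were proved in [4]»).  Rows B6.Prop2.6 × B9.Thm3.3 × B9.Cor3.5 (cells only; no row head changes).

WHY THIS FILE (director-ym №606, road (B5): the bond rows of the N06 (γ) heads discharged MODULO the printed Dirichlet fact taken BY NAME; dag-lead g46
WORDS 814; this seat's LOCATED-33/34).  The `U = 1` input of Cor. 3.5 for print's Dirichlet BOND cube letter `G_□ = (Ω₀(Δ_loc − DP_□D*)Ω₀)⁻¹` is the
decay of a real bond kernel `K` (the inverse of the compression of the flat operator to the bonds over `Ω₀(□)`), which print takes from [4] Prop. 2.6
for `G(Ω)` (p. 248).  The tree's `B6.Prop26DirichletPrinted geo Dom adm GΩ` quantifies over an ABSTRACT family `GΩ : ∀ i, Dom i → GFamily (geo i)` —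
«the operator seen through the quantities of (2.136)–(2.140)».  THIS FILE supplies the two pieces a consumer needs to READ that named fact (or any
(2.136)-shaped decay statement) for a bond kernel of the cube sequence in the currency of r05's `B9Cor35GCubeInputsAtOne.thm33_GK_cube` (the `U = 1`
inputs `hG`, `hDG`, `hLapG` of the bond-sector `G`-step): (i) the [4]-geometry of the cube sequence whose LOCALISATION SORT hosts bond arguments
(`geoDirB i □`: sites = r05's cube blocks `BlkCubeY i □`, `d = d_T`, `η, L, M` of the member — as p33's `geoCK i □` — and `Loc := (J, b)` = a real bond
function read at a bond, `supp J ⊂ Δ(y′)` through the V1 bond block map `blkV1`, `|J| = ‖J‖_∞`), (ii) the `GFamily` of a real bond matrix `K`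
(`gFamOfKernelB i □ K`: (2.136)'s four pointwise quantities `|(KJ)(b)|`, `Σ_ν|(∇_νKJ)(b)|`, `0`, `|(ΔKJ)(b)|` for `b ∈ Δ(y)`, with the V1 lineage's
continuum-unit bond difference letters `DV ν c_f`, `LapV c_f`; the Hölder / `L²` carriers set to `0` — a WEAKENING, declared), and (iii) the reading
★`hasMajorant_of_ineq2136`: `Ineq2136_2140 (gFamOfKernelB i □ K) C … δ₃` gives `K ≺ C·(Lⁿη)²·e^{−δ₃d}`, `∇_ν·K ≺ C·(Lⁿη)·e^{−δ₃d}` (all `ν`),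
`Δ·K ≺ C·e^{−δ₃d}` over `toB6 (geoCK i □) Rr H` keyed by the bond block map ([4] (2.51)).  FILE 2 (`B9Cor35GDirInputsAtOne`) instantiates the named fact
at print's Dirichlet bond letter and lifts these rows to the realified letters.

WHAT IS PROVED (2 `def`s with bodies — `geoDirB`, `gFamOfKernelB`; theorems; 0 sorry; 0 `def … : Prop`; 0 new named facts; standard axioms):
* §1 `geoDirB i q : B6.Geometry` + its `rfl`/bookkeeping lemmas (`geoDirB_len`, `geoDirB_dist`, `geoDirB_M`, `suppIn_of_blockSupp`, `supNorm_le_of_blockSupp`);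
* §2 `gFamOfKernelB i q K : B6.GFamily (geoDirB i q)` + the evaluation lemmas `gFam_e0/e1/e3_self`;
* §3 ★`hasMajorant_of_ineq2136` (the three rows) and its corollaries `hasMajorant_K_of_ineq2136`, `hasMajorant_DV_K_of_ineq2136`, `hasMajorant_LapV_K_of_ineq2136`.

HONEST SCOPE / NOT CLAIMED.  Pure dictionary: NO decay is proved here and the named fact is NOT assumed in this file (it is FILE 2's displayed hypothesis);
`Hyp21_22 := True` for `geoDirB` because the geometric hypotheses (2.1)–(2.2) of the cube sequence are STRUCTURE FIELDS of r05's `cubeFam` and of the index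
`KIdx` (`hR2 : 2L² ≤ R`, `hM8`, `hℓ : L ≥ 5`, `hpl`), exactly as in the V1 census geometry `kGeo` (print p. 408: «This sequence satisfies the conditions (2.1),
(2.2)»); the right entry (2.136)₃ `G∇*` and (2.137)–(2.140) are not read (carriers `0`); `|∇GJ|` is read as the `ℓ¹` sum over directions (constants absorb).
Nothing on `d = 4`, the continuum, reflection positivity or the mass gap; NOT a node discharge; count-neutral (`--supports`); no row head changes.

RELATED IN THE TREE, NOT DUPLICATED: p33's `B9CubeGeometryInputs.geoCK` (same sites/metric, trivial localisation sorts — used for the OUTPUT rows),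
V1's `B6KLevelCensusIndexV1.kGeo` (member geometry, index-bond arguments), `B9FromB6.DictAtOne` (abstract B9↔B6 dictionary at `U = 1`),
`B6Prop26DirichletPrinted` (the named fact; not imported here), r05's `B9Cor35GCubeInputsAtOne` §2 (the same three rows for the WHOLE-TORUS cube letter, proved
from the V1 torus edition of Prop. 2.6).
-/

noncomputable section

namespace Literature.MathematicalPhysics.QuantumFieldTheory.Balaban1983to89.B9Prop26DirichletBondReading

open Literature.MathematicalPhysics.QuantumFieldTheory.Balaban1983to89
open Literature.MathematicalPhysics.QuantumFieldTheory.Balaban1983to89.B6RandomWalk (HasMajorant BlockSupp hasMajorant_mono)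
open Literature.MathematicalPhysics.QuantumFieldTheory.Balaban1983to89.B9Thm34Ext (toB6)
open Literature.MathematicalPhysics.QuantumFieldTheory.Balaban1983to89.B6KLevelCensusIndexV1 (KIdx kGeo)
open Literature.MathematicalPhysics.QuantumFieldTheory.Balaban1983to89.B6Cover236MultiLevelBlocks (cubes)
open Literature.MathematicalPhysics.QuantumFieldTheory.Balaban1983to89.B6GlobalChartV1L0 (blkV1)
open Literature.MathematicalPhysics.QuantumFieldTheory.Balaban1983to89.B6GradLegKLevelV1 (DV)
open Literature.MathematicalPhysics.QuantumFieldTheory.Balaban1983to89.B6LapLegKLevelV1 (LapV)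
open Literature.MathematicalPhysics.QuantumFieldTheory.Balaban1983to89.B9CubeLettersOpsL0 (cubeFamY)
open Literature.MathematicalPhysics.QuantumFieldTheory.Balaban1983to89.B9CubeLettersBondOpsL0 (BlkCubeY)
open Literature.MathematicalPhysics.QuantumFieldTheory.Balaban1983to89.B9CubeGeometryInputs (geoCK geoCK_len geoCK_len_pos geoCK_dist)
open Literature.MathematicalPhysics.QuantumFieldTheory.Balaban1983to89.Node00 (FBondY toKT)
open scoped Matrix

variable {d ℓ : ℕ} {hd : 1 ≤ d + 1} {hL : Odd (ℓ + 1) ∧ 1 < ℓ + 1} {b₀ b₁ : ℝ}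

/-! ## §1  The [4]-geometry of the cube sequence with BOND arguments -/

section Geometry

variable (i : KIdx d ℓ hd hL b₀ b₁) (q : ↥(cubes (toKT i).D.toDomains))

/-- **THE [4]-GEOMETRY OF THE CUBE SEQUENCE `{Ω_n(□)}` WITH BOND ARGUMENTS**: sites = r05's cube blocks `𝔅_□` (`BlkCubeY i □`, scale = level,
`d = d_T`, the member's `η, L, M = L·M_h, R`, as p33's `geoCK i □`); localisation sort `Loc := (J, b)` — a real bond function `J` READ AT the bond `b`
(print's «(GJ)(x), x ∈ Δ(y)»), `supp J ⊂ Δ(y′)` through the V1 bond block map (a bond sits in the block of its source site), `|J| := ‖J‖_∞`; the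
cut-off sorts are not read (trivial).  `Hyp21_22 := True`: (2.1)–(2.2) for the cube sequence are structure fields of `cubeFam` and of `KIdx` (as in `kGeo`).
[cite: Balaban1984PropagatorsII, (2.1)–(2.4) p.224, (2.46) p.231, (2.136) p.247; Balaban1985BackgroundPropagators, p.408 («This sequence satisfies the conditions (2.1), (2.2)»)] -/
def geoDirB : B6.Geometry where
  Site := BlkCubeY i q
  fin := inferInstance
  scale := fun s => s.1.1
  dist := fun s t => (geoCK i q).dist s t
  k := (kGeo i).k
  eta := (kGeo i).eta
  L := (kGeo i).L
  R := (i.R : ℝ)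
  M := (kGeo i).M
  Hyp21_22 := True
  Loc := (FBondY i → ℝ) × FBondY i
  suppIn := fun J y' => ∀ b : FBondY i, blkV1 i.hN (cubeFamY i q) b ≠ y' → J.1 b = 0
  supNorm := fun J => ‖J.1‖
  l2Norm := fun _ => 0
  holder := fun _ _ => 0
  Cut := Unit
  cutIn := fun _ _ => True
  cutH := fun _ _ => 0
  cutSup := fun _ => 0

/-- the sites of `geoDirB` are the cube blocks. [cite: Balaban1984PropagatorsII, (2.4) p.224, bookkeeping] -/
@[simp] theorem geoDirB_Site : (geoDirB i q).Site = BlkCubeY i q := rfl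

/-- `Lⁿη` in `geoDirB` is `Lⁿη` in `geoCK`. [cite: Balaban1984PropagatorsII, (2.1) p.224, bookkeeping] -/
theorem geoDirB_len (y : BlkCubeY i q) : (geoDirB i q).len y = (geoCK i q).len y := by
  show (((ℓ + 1 : ℕ) : ℝ)) ^ y.1.1 * (kGeo i).eta = _
  rw [geoCK_len]
  push_cast
  ring

/-- `d(y, y′)` in `geoDirB` is `d_T` of the cube family (= `geoCK`'s). [cite: Balaban1984PropagatorsII, (2.46) p.231, bookkeeping] -/
theorem geoDirB_dist (y y' : BlkCubeY i q) : (geoDirB i q).dist y y' = (geoCK i q).dist y y' := rfl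

/-- `M = L·M_h`. [cite: Balaban1984PropagatorsII, (2.1)–(2.2) p.224, bookkeeping] -/
theorem geoDirB_M : (geoDirB i q).M = ((ℓ : ℝ) + 1) * (i.Mh : ℝ) := by
  show (((ℓ + 1 : ℕ) : ℝ)) * (i.Mh : ℝ) = _
  push_cast
  ring

/-- (2.1)–(2.2) for the cube sequence: nothing to assume (structure fields). [cite: Balaban1985BackgroundPropagators, p.408; Balaban1984PropagatorsII, (2.1)–(2.2) p.224, bookkeeping] -/
theorem geoDirB_hyp : (geoDirB i q).Hyp21_22 := trivial

/-- a block-supported bond function (the `BlockSupp` of the majorant calculus) is an argument with `supp J ⊂ Δ(y′)` of `geoDirB`, read at any bond.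
[cite: Balaban1984PropagatorsII, (2.51) p.232 («supp λ ⊂ B^{j′}(y′)»), bookkeeping] -/
theorem suppIn_of_blockSupp {μ : FBondY i → ℝ} {y' : BlkCubeY i q} {B : ℝ} (hμ : BlockSupp (g := toB6 (geoCK i q) 0 True) (blkV1 i.hN (cubeFamY i q)) μ y' B)
    (b : FBondY i) : (geoDirB i q).suppIn (μ, b) y' :=
  fun b' hb' => hμ.off b' hb'

/-- … and its sup norm is at most the block bound `B`. [cite: Balaban1984PropagatorsII, (2.51) p.232 («|λ|»), bookkeeping] -/
theorem supNorm_le_of_blockSupp {μ : FBondY i → ℝ} {y' : BlkCubeY i q} {B : ℝ} (hμ : BlockSupp (g := toB6 (geoCK i q) 0 True) (blkV1 i.hN (cubeFamY i q)) μ y' B)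
    (b : FBondY i) : (geoDirB i q).supNorm (μ, b) ≤ B := by
  show ‖μ‖ ≤ B
  refine (pi_norm_le_iff_of_nonneg hμ.nonneg).2 fun b' => ?_
  rw [Real.norm_eq_abs]
  by_cases h : blkV1 i.hN (cubeFamY i q) b' = y'
  · exact hμ.bound b' h
  · rw [hμ.off b' h, abs_zero]; exact hμ.nonneg

end Geometry

/-! ## §2  The `GFamily` of a real bond kernel: (2.136)'s pointwise quantities -/

section Family

variable (i : KIdx d ℓ hd hL b₀ b₁) (q : ↥(cubes (toKT i).D.toDomains))

/-- **A REAL BOND KERNEL `K` SEEN THROUGH THE QUANTITIES OF (2.136)**: for the argument `(J, b)` and the block `y`, `e 0 = |(KJ)(b)|`, `e 1 = Σ_ν|(∇_νKJ)(b)|`,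
`e 2 = 0` (the right entry `K∇*` is not read), `e 3 = |(ΔKJ)(b)|` when `b ∈ Δ(y)` (else `0`), with the V1 lineage's continuum-unit bond differences
`∇_ν = DV ν c_f`, `Δ = LapV c_f`; the Hölder ∕ (2.138)–(2.140) carriers are `0` (not read).
[cite: Balaban1984PropagatorsII, Prop. 2.6 (2.136) p.247; Balaban1985BackgroundPropagators, (3.42) p.397, p.409 l.1–5] -/
def gFamOfKernelB (K : Matrix (FBondY i) (FBondY i) ℝ) : B6.GFamily (geoDirB i q) where
  e n J y := if blkV1 i.hN (cubeFamY i q) J.2 = y then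
      (![|(K *ᵥ J.1) J.2|, ∑ ν : Fin (d + 1), |DV (P := B6GlobalChartV1.PV d ℓ i.m i.K hd hL) ν i.cf (K *ᵥ J.1) J.2|, 0,
        |LapV (P := B6GlobalChartV1.PV d ℓ i.m i.K hd hL) i.cf (K *ᵥ J.1) J.2|] : Fin 4 → ℝ) n
    else 0
  h1 _ _ _ := 0
  e4 _ _ := 0
  h2 _ _ _ := 0
  l2 _ _ _ := 0

variable (K : Matrix (FBondY i) (FBondY i) ℝ)

/-- `e 0` at the bond's own block is `|(KJ)(b)|`. [cite: Balaban1984PropagatorsII, (2.136)₁ p.247, bookkeeping] -/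
theorem gFam_e0_self (J : FBondY i → ℝ) (b : FBondY i) :
    (gFamOfKernelB i q K).e 0 (J, b) (blkV1 i.hN (cubeFamY i q) b) = |(K *ᵥ J) b| := by
  simp [gFamOfKernelB]

/-- `e 1` at the bond's own block is `Σ_ν|(∇_νKJ)(b)|`. [cite: Balaban1984PropagatorsII, (2.136)₂ p.247, bookkeeping] -/
theorem gFam_e1_self (J : FBondY i → ℝ) (b : FBondY i) :
    (gFamOfKernelB i q K).e 1 (J, b) (blkV1 i.hN (cubeFamY i q) b) =
      ∑ ν : Fin (d + 1), |DV (P := B6GlobalChartV1.PV d ℓ i.m i.K hd hL) ν i.cf (K *ᵥ J) b| := by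
  simp [gFamOfKernelB]

/-- `e 3` at the bond's own block is `|(ΔKJ)(b)|`. [cite: Balaban1984PropagatorsII, (2.136)₄ p.247, bookkeeping] -/
theorem gFam_e3_self (J : FBondY i → ℝ) (b : FBondY i) :
    (gFamOfKernelB i q K).e 3 (J, b) (blkV1 i.hN (cubeFamY i q) b) = |LapV (P := B6GlobalChartV1.PV d ℓ i.m i.K hd hL) i.cf (K *ᵥ J) b| := by
  simp only [gFamOfKernelB, if_true]
  rfl

end Family

/-! ## §3  ★ The reading: (2.136) for `gFamOfKernelB i □ K` ⇒ the three (3.42)-type rows over `toB6 (geoCK i □)` -/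

section Reading

variable (i : KIdx d ℓ hd hL b₀ b₁) (q : ↥(cubes (toKT i).D.toDomains)) (K : Matrix (FBondY i) (FBondY i) ℝ)

/-- `pref4 t 0 = t²`, `pref4 t 1 = t`, `pref4 t 3 = 1`. [cite: Balaban1984PropagatorsII, (2.136) p.247, bookkeeping] -/
theorem pref4_vals (t : ℝ) : B6.pref4 t 0 = t ^ 2 ∧ B6.pref4 t 1 = t ∧ B6.pref4 t 3 = 1 := by
  refine ⟨rfl, rfl, ?_⟩
  rfl

/-- ★ **THE READING**: if the kernel `K` satisfies (2.136)–(2.140) in the sense of `Ineq2136_2140 (gFamOfKernelB i □ K)` with a constant `C ≥ 0` and rate `δ₃`,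
then over the cube geometry `toB6 (geoCK i □) Rr H`, keyed by the bond block map, `K ≺ C·(Lⁿη)²·e^{−δ₃d}`, `∇_ν·K ≺ C·(Lⁿη)·e^{−δ₃d}` for every `ν`, and
`Δ·K ≺ C·e^{−δ₃d}` ([4] (2.51): `|(Tλ)(x)| ≤ K(y,y′)|λ|` for `x ∈ Δ(y)`, `supp λ ⊂ Δ(y′)`).
[cite: Balaban1984PropagatorsII, Prop. 2.6 (2.136) p.247, (2.51) p.232; Balaban1985BackgroundPropagators, Thm 3.3 p.399, (3.42) p.397, Cor. 3.5 p.407, p.409 l.1–5] -/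
theorem hasMajorant_of_ineq2136 (Rr : ℝ) (H : Prop) {C δ₃ : ℝ} {Cα Cε : ℝ → ℝ} {Cαε : ℝ → ℝ → ℝ} (hC : 0 ≤ C)
    (h : B6.Ineq2136_2140 (gFamOfKernelB i q K) C Cα Cε Cαε δ₃) :
    HasMajorant (g := toB6 (geoCK i q) Rr H) (blkV1 i.hN (cubeFamY i q)) (Matrix.toLin' K)
        (fun y y' => C * (geoCK i q).len y ^ 2 * Real.exp (-(δ₃ * (geoCK i q).dist y y'))) ∧
    (∀ ν : Fin (d + 1), HasMajorant (g := toB6 (geoCK i q) Rr H) (blkV1 i.hN (cubeFamY i q))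
        (DV (P := B6GlobalChartV1.PV d ℓ i.m i.K hd hL) ν i.cf ∘ₗ Matrix.toLin' K)
        (fun y y' => C * (geoCK i q).len y * Real.exp (-(δ₃ * (geoCK i q).dist y y')))) ∧
    HasMajorant (g := toB6 (geoCK i q) Rr H) (blkV1 i.hN (cubeFamY i q))
        (LapV (P := B6GlobalChartV1.PV d ℓ i.m i.K hd hL) i.cf ∘ₗ Matrix.toLin' K)
        (fun y y' => C * Real.exp (-(δ₃ * (geoCK i q).dist y y'))) := by
  obtain ⟨h1, -, -, -, -⟩ := h
  -- the common step: (2.136) at the argument `(μ, b)`, the block `y = Δ(b)` and `y′`, with `|μ| ≤ B`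
  have key : ∀ (n : Fin 4) (y' : BlkCubeY i q) (μ : FBondY i → ℝ) (B : ℝ),
      BlockSupp (g := toB6 (geoCK i q) Rr H) (blkV1 i.hN (cubeFamY i q)) μ y' B → ∀ b : FBondY i,
      (gFamOfKernelB i q K).e n (μ, b) (blkV1 i.hN (cubeFamY i q) b) ≤
        C * B6.pref4 ((geoCK i q).len (blkV1 i.hN (cubeFamY i q) b)) n *
          Real.exp (-(δ₃ * (geoCK i q).dist (blkV1 i.hN (cubeFamY i q) b) y')) * B := by
    intro n y' μ B hμ b
    have hμ' : BlockSupp (g := toB6 (geoCK i q) 0 True) (blkV1 i.hN (cubeFamY i q)) μ y' B := ⟨hμ.nonneg, hμ.bound, hμ.off⟩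
    have h := h1 n (μ, b) (blkV1 i.hN (cubeFamY i q) b) y' (suppIn_of_blockSupp i q hμ' b)
    rw [geoDirB_len, geoDirB_dist] at h
    refine h.trans (mul_le_mul_of_nonneg_left (supNorm_le_of_blockSupp i q hμ' b) ?_)
    have hpref : 0 ≤ B6.pref4 ((geoCK i q).len (blkV1 i.hN (cubeFamY i q) b)) n := by
      have hl := (geoCK_len_pos i q (blkV1 i.hN (cubeFamY i q) b)).le
      fin_cases n
      · exact sq_nonneg _
      · exact hl
      · exact hl
      · exact zero_le_one
    exact mul_nonneg (mul_nonneg hC hpref) (Real.exp_pos _).le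
  refine ⟨?_, fun ν => ?_, ?_⟩
  · intro y' μ B hμ b
    have h := key 0 y' μ B hμ b
    rw [gFam_e0_self, (pref4_vals _).1] at h
    rwa [Matrix.toLin'_apply]
  · intro y' μ B hμ b
    have h := key 1 y' μ B hμ b
    rw [gFam_e1_self, (pref4_vals _).2.1] at h
    rw [LinearMap.comp_apply, Matrix.toLin'_apply]
    refine le_trans ?_ h
    exact Finset.single_le_sum (f := fun ν => |DV (P := B6GlobalChartV1.PV d ℓ i.m i.K hd hL) ν i.cf (K *ᵥ μ) b|)
      (fun ν _ => abs_nonneg _) (Finset.mem_univ ν)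
  · intro y' μ B hμ b
    have h := key 3 y' μ B hμ b
    rw [gFam_e3_self, (pref4_vals _).2.2, mul_one] at h
    rwa [LinearMap.comp_apply, Matrix.toLin'_apply]

/-- corollary: the `G`-row alone. [cite: Balaban1984PropagatorsII, (2.136)₁ p.247; Balaban1985BackgroundPropagators, (3.42)₁ p.397, Cor. 3.5 p.407] -/
theorem hasMajorant_K_of_ineq2136 (Rr : ℝ) (H : Prop) {C δ₃ : ℝ} {Cα Cε : ℝ → ℝ} {Cαε : ℝ → ℝ → ℝ} (hC : 0 ≤ C)
    (h : B6.Ineq2136_2140 (gFamOfKernelB i q K) C Cα Cε Cαε δ₃) :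
    HasMajorant (g := toB6 (geoCK i q) Rr H) (blkV1 i.hN (cubeFamY i q)) (Matrix.toLin' K)
      (fun y y' => C * (geoCK i q).len y ^ 2 * Real.exp (-(δ₃ * (geoCK i q).dist y y'))) :=
  (hasMajorant_of_ineq2136 i q K Rr H hC h).1

/-- corollary: the `∇_νG`-rows. [cite: Balaban1984PropagatorsII, (2.136)₂ p.247; Balaban1985BackgroundPropagators, (3.42)₂ p.397, Cor. 3.5 p.407] -/
theorem hasMajorant_DV_K_of_ineq2136 (Rr : ℝ) (H : Prop) {C δ₃ : ℝ} {Cα Cε : ℝ → ℝ} {Cαε : ℝ → ℝ → ℝ} (hC : 0 ≤ C)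
    (h : B6.Ineq2136_2140 (gFamOfKernelB i q K) C Cα Cε Cαε δ₃) (ν : Fin (d + 1)) :
    HasMajorant (g := toB6 (geoCK i q) Rr H) (blkV1 i.hN (cubeFamY i q))
      (DV (P := B6GlobalChartV1.PV d ℓ i.m i.K hd hL) ν i.cf ∘ₗ Matrix.toLin' K)
      (fun y y' => C * (geoCK i q).len y * Real.exp (-(δ₃ * (geoCK i q).dist y y'))) :=
  (hasMajorant_of_ineq2136 i q K Rr H hC h).2.1 ν

/-- corollary: the `ΔG`-row. [cite: Balaban1984PropagatorsII, (2.136)₄ p.247; Balaban1985BackgroundPropagators, (3.42) p.397, Cor. 3.5 p.407] -/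
theorem hasMajorant_LapV_K_of_ineq2136 (Rr : ℝ) (H : Prop) {C δ₃ : ℝ} {Cα Cε : ℝ → ℝ} {Cαε : ℝ → ℝ → ℝ} (hC : 0 ≤ C)
    (h : B6.Ineq2136_2140 (gFamOfKernelB i q K) C Cα Cε Cαε δ₃) :
    HasMajorant (g := toB6 (geoCK i q) Rr H) (blkV1 i.hN (cubeFamY i q))
      (LapV (P := B6GlobalChartV1.PV d ℓ i.m i.K hd hL) i.cf ∘ₗ Matrix.toLin' K)
      (fun y y' => C * Real.exp (-(δ₃ * (geoCK i q).dist y y'))) :=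
  (hasMajorant_of_ineq2136 i q K Rr H hC h).2.2

end Reading

end Literature.MathematicalPhysics.QuantumFieldTheory.Balaban1983to89.B9Prop26DirichletBondReading
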